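import Summits.QuantumFields.BalabanUV.T4Continuum.Support.ShellMeasureLandauHolonomySkew
import Summits.QuantumFields.BalabanUV.T4Continuum.Support.ShellMeasureWindowBall

/-!
# `T4Continuum.ShellMeasureLandauHolonomyPrint` — THE S22 END READ IN PRINT, MEASURE SIDE INCLUDED: END-II's
# per-section FINITENESS proviso is a THEOREM on the S22 road (the defined weight is bounded on the chart cube), the
# window is print's (1.27) ball SUPPORT, and the scheme numerics are Prop. 6 / Prop. 3's PRINTED smallness
(cell `pub-balaban`, sub-cell `t4`, spine estimate NE7c (node U5b); NE7c formalisation swarm, crew seat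
`b2b-balaban-t4-ne7c-formalise-leaf-02` gen 5 — file (G) of the OFFERED row S22 after gen 4's (A)–(F); imports (F)
`ShellMeasureLandauHolonomySkew` (p215096) and S20 `ShellMeasureWindowBall` (p209596, leaf-10) ONLY; [folklore];
0 `def`, 0 `def … : Prop`, 0 sorry, 0 citations)

HONEST FRAMING.  Finite four-torus programme, rung (B)+1 only — NOT infinite volume, NOT a mass gap, NOT the Clay
problem, NOT summit progress; (B), `BetaPertHyp`, (B^μ) not consumed.  NE7c (`T4IndicatorShell.ShellWeightBound`) is
NOT PRINTED and NOT PROVED; «NE7c ⇐ the named binders»; (M1) realized ≠ NE7c (c3).  Nothing printed is asserted: the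
equation numbers below LOCATE the displayed SHAPES of binders, they are not citations.

WHY.  File (F)'s END `slotAC_realized_su2_landauChart_threeSided_skew` still carries three binder groups that are NOT
estimates of Bałaban's: END-II's measure-side proviso `hfin` (finite mass of every `T`-gauged section of `F`) with the
free block weight `R`/`hR` and the window FACTORISATION `hFw`; and the ABSTRACT scheme numerics `hdom`/`hself`/`hcontr`
((118)/(121) at `a = B₀b`, `j = θ = 0`), `hq`/`hRC` ((54) at `ε₄ + B₀b`).  This file retires them:
* §1 `norm_wordExp_le_one`, `weight_le_of_bounds` — a word of letters with contracting exponentials has norm `≤ 1`;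
  A3's weight `e^{−(β Σ_p (1 − τ(G_p x)/N) + 𝓔 x)}` is `≤ e^{B}` once `‖G_p x‖ ≤ 1` on `P_w` (`τ ≤ N‖·‖`, `T.abs_le`)
  and `−B ≤ 𝓔 x` (generic).
* §2 `hfin_of_cubeBound` — GENERIC at E2′'s level (`G = SU(2)`): `hFw` plus a bound `R V (κ_{cV} x) ≤ K < ∞` on the
  chart cube give `hfin` — the section mass is the chart-law mass (`ShellMeasureScalingSU2.chartLaw_univ_eq`), the
  Jacobian factor `e^{−jac_e}` is largest at the centre (`exp_neg_expJac_le_smul` at `c = 0`), the cube has finite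
  Lebesgue measure (`chartCube_subset_closedBall`).
* §3 `landauField_mem_ball`, `landauWeight_le` — ON THE S22 ROAD the bound holds with `K = e^{H̄/2}`: at a real chart
  point `‖y‖ ≤ S` the exponent field `Z_V y` is real (file (A) `landauField_mem_real`), so every weight read-out is
  skew-adjoint with a unitary exponential (file (F) `hℓr_matrix_readOutReal`) and the weight words have norm `≤ 1`;
  and `Z_V y ∈ ball 0 r_E` (file (D) `landauCurve_mapsTo` at `σ = 1 < r_Φ/S`), so `𝓔_V y ≥ −Σ_i e_i ≥ −H̄/2`.
* §4 **`slotAC_realized_su2_landauChart_print`** — (F)'s END with {`R`, `hR`, `hFw`, `hfin`, `hdom`, `hself`,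
  `hcontr`, `hq`, `hRC`} GONE; in their place the ball SUPPORT `hFsupp` of the `T`-gauged sections (print's (1.27)
  SHAPE `|V_j(b)(V^{(j)}(b))⁻¹ − 1| < 2δ′_j` read as `dist1 ((c V b)⁻¹ y_b) ≤ 2 sin(S/2)`; S20 `window_of_ballSupport` BY
  NAME), `hJ1 : Jco ≤ 1` (the kept co-tests are indicators), and Prop. 6 / Prop. 3's PRINTED smallness
  `2B₀C₁B₃ε₁ ≤ ε₄`, `4ε₄ ≤ a₃`, `16B₀C₄ε₄ ≤ 1`, `dL ≤ B₃` (p. 295), `18C₂B₀ε₃ ≤ 1` (p. 286), the located coupling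
  `ε₄ + 2dLB₀C₁ε₁ ≤ ε₃`, `3ε₃ ≤ R_C` (LD f3 `scheme_numbers_of_printed`/`sectC_numbers_of_printed` BY NAME), the
  coarse-field bound being print's `b := 2dLC₁ε₁` ((75)); `hRdict` reads on the density's OWN sections (S20's form).
  CONCLUSION: E2′'s, literally, in that currency; ONE application of (F)'s END.
AFTER THIS FILE a live slot's realized (M1) on the S22 road ASKS: `F` (gauge-invariant, measurable, (1.27)-supported),
`u`, the dictionaries `hRdict`/`hudict` on the chart cube, the co-tests (`hJW`/`hJ`/`hJ1`, `W V ⊆ B̄_S`), the scheme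
OPERATORS (P2)/(P4)/(103)/(75)/(44)/(46) + scaling as displayed-TYPE data with V-uniform constants, Prop. 6 / Prop. 3's
printed smallness + the coupling, read-outs and per-term pairs with `m_w κ_w z̄ ≤ 1` and `z̄ ≤ r_E`, the real
structure's preservation, the numbers, (SM) in the currency `Rad = r_Φ/S` — ALL DISPLAYED, none discharged; `hfin` is no
longer among them.  NOT an instance of Bałaban's minimiser or effective action; NOTHING in the countdown moves; NE7c
NOT PROVED; spine PROVED 0/9.  HONEST DEPENDENCY (cell): continuum YM on T⁴ ⇐ BetaPertH ∧ nine spine estimates (0/9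
proved); BetaPertH ⇐ (D1) ∧ (D4) ∧ CAP+tail; G-an2-4 gates asym, D1 and NE2/3/4.
-/

noncomputable section

open Set Metric NormedSpace MeasureTheory Function

namespace Summit.QuantumFields.BalabanUV.T4Continuum.ShellMeasureLandauHolonomyPrint

open scoped ENNReal
open Literature.MathematicalPhysics.QuantumFieldTheory.Balaban1983to89
open B11Prop6Scheme (Prop4Hyp)
open GaugeField (GaugeInvariant)
open T4ShellMeasure (SlotAntiConcentration)
open T4CubePoincare (cube mem_cube_iff measurableSet_cube')
open T4CubeChartGnomonic (SU2)
open T4CubeChartExp (expJac expWindowDensity expFibreChart)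
open T4ShellMeasureDet (blockLaw)
open T4TreeGaugeFixing (NoClosedLoop fixTo measurable_fixTo)
open ShellMeasureWilsonWords (wordExp wordExp_nil wordExp_cons)
open ShellMeasureWilsonTrace (TraceData)
open ShellMeasureWilsonBlock (matrixTrace matrixTrace_N_pos)
open ShellMeasureScalingSU2 (chartLaw_univ_eq exp_neg_expJac_le_smul)
open ShellMeasureLevelAssembly (classifier weight action)
open ShellMeasureLandauExponent (currentData_zero)
open ShellMeasureLandauHolonomy (solAt landauExp)
open ShellMeasureLandauHolonomyChart (holOf holOf_apply cplx rayData_chart)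
open ShellMeasureLandauHolonomyReal (landauField_mem_real)
open ShellMeasureLandauHolonomyTermsEnd (landauCurve_mapsTo)
open ShellMeasureLandauHolonomySkew (readOutReal isClosed_readOutReal hℓr_matrix_readOutReal
  slotAC_realized_su2_landauChart_threeSided_skew)
open ShellMeasureLandauPrinted (scheme_numbers_of_printed sectC_numbers_of_printed)
open ShellMeasureWindowBall (window_of_ballSupport)

/-! ## §1 Contracting words and a bound on the Boltzmann weight -/

section Weight

variable {A : Type*} [NormedRing A] [NormOneClass A]

/-- **A WORD OF LETTERS WITH CONTRACTING EXPONENTIALS HAS NORM `≤ 1`.** [folklore] -/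
theorem norm_wordExp_le_one : ∀ l : List A, (∀ a ∈ l, ‖exp a‖ ≤ 1) → ‖wordExp l‖ ≤ 1
  | [], _ => by rw [wordExp_nil, norm_one]
  | (Y :: l), h => by
      rw [wordExp_cons]
      have hY : ‖exp Y‖ ≤ 1 := h Y List.mem_cons_self
      have hl : ‖wordExp l‖ ≤ 1 := norm_wordExp_le_one l fun a ha => h a (List.mem_cons_of_mem Y ha)
      exact (norm_mul_le _ _).trans ((mul_le_mul hY hl (norm_nonneg _) zero_le_one).trans_eq (one_mul _))

variable [NormedAlgebra ℂ A] {m₀ : ℕ}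

omit [NormOneClass A] in
/-- **THE BOLTZMANN WEIGHT OF A3 IS BOUNDED WHEN THE WEIGHT WORDS CONTRACT AND THE NON-WILSON TERM IS BOUNDED BELOW**:
`‖G_p x‖ ≤ 1` on `P_w` (so `τ(G_p x) ≤ N‖G_p x‖ ≤ N`, each Wilson summand `1 − τ/N ≥ 0`), `β ≥ 0`, `−B ≤ 𝓔 x` ⟹
`weight T β P_w G 𝓔 x ≤ e^{B}`. [folklore] -/
theorem weight_le_of_bounds (T : TraceData A) (hN : 0 < T.N) {β : ℝ} (hβ : 0 ≤ β) {𝔭 : Type*} (Pw : Finset 𝔭)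
    {G : 𝔭 → (Fin m₀ → ℝ) → A} {𝓔 : (Fin m₀ → ℝ) → ℝ} {x : Fin m₀ → ℝ} {B : ℝ}
    (hG : ∀ p ∈ Pw, ‖G p x‖ ≤ 1) (h𝓔 : -B ≤ 𝓔 x) :
    weight T β Pw G 𝓔 x ≤ ENNReal.ofReal (Real.exp B) := by
  unfold weight action
  refine ENNReal.ofReal_le_ofReal (Real.exp_le_exp.2 ?_)
  have hsum : 0 ≤ ∑ p ∈ Pw, (1 - T.τ (G p x) / T.N) := Finset.sum_nonneg fun p hp => by
    have h1 : T.τ (G p x) ≤ T.N := by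
      have habs : T.τ (G p x) ≤ T.N * ‖G p x‖ := (le_abs_self _).trans (T.abs_le (G p x))
      have hle : T.N * ‖G p x‖ ≤ T.N * 1 := mul_le_mul_of_nonneg_left (hG p hp) hN.le
      linarith
    rw [sub_nonneg, div_le_one hN]; exact h1
  nlinarith [mul_nonneg hβ hsum]

end Weight

/-! ## §2 END-II's per-section finiteness from a bound on the chart cube (generic, `G = SU(2)`) -/

section Finite

variable {P : Params} {j : ℕ} [DecidableEq (PBond P j)]

omit [DecidableEq (PBond P j)] in
/-- the chart cube `[-S,S]ⁿ` lies in the closed sup-norm ball of radius `S` (in fact they coincide). [folklore] -/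
theorem chartCube_subset_closedBall {n : ℕ} {S : ℝ} (hS : 0 ≤ S) : cube n S ⊆ closedBall (0 : Fin n → ℝ) S := by
  intro y hy
  rw [mem_cube_iff] at hy
  exact mem_closedBall_zero_iff.2 ((pi_norm_le_iff_of_nonneg hS).2 fun i => by rw [Real.norm_eq_abs]; exact hy i)

/-- **END-II's `hfin` FROM A BOUND ON THE CHART CUBE.**  E2′'s measure-side binders `T`, `U₀`, `Λ`, `e`, `0 < S`,
`3S² < π²`, `c`, measurable block weights `R V` with the window factorisation `hFw` of `F`, VERBATIM: if
`R V (κ_{cV} x) ≤ K < ∞` for `x ∈ [-S,S]ⁿ`, every `T`-gauged `V`-section of `F` has FINITE block-Haar mass — it equals the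
chart-law mass (`chartLaw_univ_eq`), whose density `1_{cube}·e^{−jac_e}·R V∘κ ≤ e^{−jac_e(0)}·K`. [folklore] -/
theorem hfin_of_cubeBound (T : Finset (PBond P j)) (U₀ : GaugeField P j SU2) (Λ : Finset (PBond P j)) {n : ℕ}
    (e : ↥Λ × Fin 3 ≃ Fin n) {S : ℝ} (hS : 0 < S) (hSπ : 3 * S ^ 2 < Real.pi ^ 2)
    (c : GaugeField P j SU2 → GaugeField P j SU2)
    {R : GaugeField P j SU2 → (↥Λ → SU2) → ℝ≥0∞} (hR : ∀ V, Measurable (R V))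
    {F : GaugeField P j SU2 → ℝ≥0∞}
    (hFw : ∀ V y, F (fixTo T U₀ (updateFinset V Λ y)) =
      ENNReal.ofReal (expWindowDensity Λ (c V) S (updateFinset (c V) Λ y)) * R V y)
    {K : ℝ≥0∞} (hK : K ≠ ∞) (hRK : ∀ V, ∀ x ∈ cube n S, R V (expFibreChart Λ (c V) e x) ≤ K)
    (V : GaugeField P j SU2) :
    ((blockLaw Λ).withDensity fun y => F (fixTo T U₀ (updateFinset V Λ y))) univ ≠ ∞ := by
  have hsecF : (fun y => F (fixTo T U₀ (updateFinset V Λ y))) =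
      fun y => ENNReal.ofReal (expWindowDensity Λ (c V) S (updateFinset (c V) Λ y)) * R V y := funext (hFw V)
  rw [hsecF, ← chartLaw_univ_eq Λ (c V) e hS hSπ (hR V), withDensity_apply _ MeasurableSet.univ,
    Measure.restrict_univ]
  have hpt : ∀ x, (cube n S).indicator (fun x => ENNReal.ofReal (Real.exp (-expJac Λ e x))) x *
      R V (expFibreChart Λ (c V) e x) ≤
      (cube n S).indicator (fun _ => ENNReal.ofReal (Real.exp (-expJac Λ e 0)) * K) x := by
    intro x
    by_cases hx : x ∈ cube n S
    · rw [indicator_of_mem hx, indicator_of_mem hx]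
      refine mul_le_mul' (ENNReal.ofReal_le_ofReal ?_) (hRK V x hx)
      have h := exp_neg_expJac_le_smul e hSπ hx (le_refl (0 : ℝ)) zero_le_one
      rwa [zero_smul] at h
    · rw [indicator_of_notMem hx, indicator_of_notMem hx, zero_mul]
  refine ne_top_of_le_ne_top ?_ (lintegral_mono hpt)
  rw [lintegral_indicator_const (measurableSet_cube' n S)]
  refine ENNReal.mul_ne_top (ENNReal.mul_ne_top ENNReal.ofReal_ne_top hK) ?_
  exact ((measure_mono (chartCube_subset_closedBall hS.le)).trans_lt measure_closedBall_lt_top).ne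

end Finite

/-! ## §3 On the S22 road the defined weight is bounded on the chart cube -/

section Landau

open scoped Matrix.Norms.L2Operator

variable {𝒴 𝒴' 𝒳 𝒵 ℬ : Type*} [NormedAddCommGroup 𝒴] [NormedSpace ℂ 𝒴] [CompleteSpace 𝒴]
  [NormedAddCommGroup 𝒴'] [NormedSpace ℂ 𝒴'] [NormedAddCommGroup 𝒳] [NormedSpace ℂ 𝒳] [CompleteSpace 𝒳]
  [NormedAddCommGroup 𝒵] [NormedSpace ℂ 𝒵] [NormedAddCommGroup ℬ] [NormedSpace ℂ ℬ]
variable {m₀ : ℕ} {𝒢 : 𝒵 →L[ℂ] 𝒴} {W𝒱 : 𝒴 → 𝒵} {B₀ C₄ a₃ : ℝ}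

/-- **THE EXPONENT FIELD AT A REAL CHART POINT LIES IN THE TERMS' BALL.**  Under the S22 point data of 7″ §3 ∕ file (D)
((P2), (P4), (118)/(121) at `a = B₀b`, (103), (75) with `S < r_Φ`, (44), scaling, (46), (54)) and the coupling `z̄ ≤ r_E`:
for `‖y‖ ≤ S` (`0 < S`) the exponent field `Z y` lies in `ball 0 r_E` — file (D)'s `landauCurve_mapsTo` along the chart
ray through `y`, read at `σ = 1 < r_Φ/S`. [folklore] -/
theorem landauField_mem_ball {S : ℝ} (hS : 0 < S)
    (h𝒢 : ∀ f, ‖𝒢 f‖ ≤ B₀ * ‖f‖) (hW : Prop4Hyp W𝒱 C₄ a₃) (hB₀ : 0 < B₀) (hC₄ : 0 ≤ C₄)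
    {b ε₄ : ℝ} (hε₄ : 0 ≤ ε₄) (hdom : 2 * (ε₄ + B₀ * b) ≤ a₃)
    (hself : B₀ * C₄ * (ε₄ + B₀ * b) ^ 2 ≤ ε₄) (hcontr : 4 * B₀ * C₄ * (ε₄ + B₀ * b) < 1)
    (H₁ : ℬ →L[ℂ] 𝒴) (hH₁ : ∀ B, ‖H₁ B‖ ≤ B₀ * ‖B‖)
    {Φ : (Fin m₀ → ℂ) → ℬ} {rΦ : ℝ} (hΦd : DifferentiableOn ℂ Φ (ball 0 rΦ)) (hΦ0 : Φ 0 = 0)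
    (hΦ : ∀ z ∈ ball (0 : Fin m₀ → ℂ) rΦ, ‖Φ z‖ < b) (hSr : S < rΦ)
    {C : 𝒴' → 𝒳} {C₂ R : ℝ} (hC₂ : 0 ≤ C₂) (hCq : ∀ Z : 𝒴', ‖Z‖ < R → ‖C Z‖ ≤ C₂ * ‖Z‖ ^ 2)
    (hCd : DifferentiableOn ℂ C (ball 0 R)) (ι : 𝒴 →L[ℂ] 𝒴') (hι : ∀ Y, ‖ι Y‖ ≤ ‖Y‖) (H : 𝒳 →L[ℂ] 𝒴)
    (hH : ∀ X, ‖H X‖ ≤ B₀ * ‖X‖) (hq : 9 * C₂ * B₀ * (ε₄ + B₀ * b) < 1) (hRC : 3 * (ε₄ + B₀ * b) ≤ R)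
    {rE : ℝ} (hcoupE : (ε₄ + B₀ * b) + B₀ * (4 * C₂ * (ε₄ + B₀ * b) ^ 2) ≤ rE)
    {y : Fin m₀ → ℝ} (hy : ‖y‖ ≤ S) :
    landauExp C ι H (4 * C₂ * (ε₄ + B₀ * b) ^ 2)
        (solAt 𝒢 0 W𝒱 ε₄ (0 : 𝒵) (H₁ (Φ (cplx y))) + H₁ (Φ (cplx y))) ∈ ball (0 : 𝒴) rE := by
  have hRad : 0 < rΦ / S := div_pos (hS.trans hSr) hS
  have hΛ : ∀ Y : 𝒴, ‖(0 : 𝒴 →L[ℂ] 𝒴) Y‖ ≤ 0 * ‖Y‖ := fun Y => by simp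
  have hself' : B₀ * 0 + 0 * (ε₄ + B₀ * b) + B₀ * C₄ * (ε₄ + B₀ * b) ^ 2 ≤ ε₄ := by simpa using hself
  have hcontr' : 0 + 4 * B₀ * C₄ * (ε₄ + B₀ * b) < 1 := by simpa using hcontr
  have hray := rayData_chart H₁ hH₁ hB₀ hΦd hΦ0 hΦ hS hy
  have hmaps := landauCurve_mapsTo h𝒢 hΛ hW hB₀.le hC₄ le_rfl hε₄ hdom hself' hcontr' hRad
    (currentData_zero (𝒵 := 𝒵) (rΦ / S)).1 hray.1 (currentData_zero (𝒵 := 𝒵) (rΦ / S)).2.1 hray.2.2.1 rfl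
    hray.2.1 hC₂ hCq hCd ι hι H hH hq hRC hcoupE
  have h1 : (1 : ℂ) ∈ ball (0 : ℂ) (rΦ / S) := by
    rw [mem_ball_zero_iff, norm_one, lt_div_iff₀ hS, one_mul]; exact hSr
  simpa only [one_smul] using hmaps h1

variable {n : Type*} [Fintype n] [DecidableEq n] [Nonempty n]

/-- **THE DEFINED WEIGHT IS BOUNDED ON THE CHART CUBE: `weight ≤ e^{H̄/2}`.**  At a real chart point `‖y‖ ≤ S` the
exponent field `Z_V y` is real (file (A) `landauField_mem_real`, with the real structure `readOutReal L` generated by a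
read-out set `L ∋` the weight read-outs), so every weight read-out `ℓ (Z_V y)` is skew-adjoint in `M_n(ℂ)` and has a
unitary exponential (file (F) `hℓr_matrix_readOutReal`): the weight words have operator norm `≤ 1`; and
`Z_V y ∈ ball 0 r_E` (`landauField_mem_ball`), so `𝓔_V y = Re Σ_i 𝓔_i(Z_V y) ≥ −Σ_i e_i ≥ −H̄/2`; then §1. [folklore] -/
theorem landauWeight_le {S : ℝ} (hS : 0 < S)
    (h𝒢 : ∀ f, ‖𝒢 f‖ ≤ B₀ * ‖f‖) (hW : Prop4Hyp W𝒱 C₄ a₃) (hB₀ : 0 < B₀) (hC₄ : 0 ≤ C₄)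
    {b ε₄ : ℝ} (hε₄ : 0 ≤ ε₄) (hdom : 2 * (ε₄ + B₀ * b) ≤ a₃)
    (hself : B₀ * C₄ * (ε₄ + B₀ * b) ^ 2 ≤ ε₄) (hcontr : 4 * B₀ * C₄ * (ε₄ + B₀ * b) < 1)
    (H₁ : ℬ →L[ℂ] 𝒴) (hH₁ : ∀ B, ‖H₁ B‖ ≤ B₀ * ‖B‖)
    {Φ : (Fin m₀ → ℂ) → ℬ} {rΦ : ℝ} (hΦd : DifferentiableOn ℂ Φ (ball 0 rΦ)) (hΦ0 : Φ 0 = 0)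
    (hΦ : ∀ z ∈ ball (0 : Fin m₀ → ℂ) rΦ, ‖Φ z‖ < b) (hSr : S < rΦ)
    {C : 𝒴' → 𝒳} {C₂ R : ℝ} (hC₂ : 0 ≤ C₂) (hCq : ∀ Z : 𝒴', ‖Z‖ < R → ‖C Z‖ ≤ C₂ * ‖Z‖ ^ 2)
    (hCd : DifferentiableOn ℂ C (ball 0 R)) (ι : 𝒴 →L[ℂ] 𝒴') (hι : ∀ Y, ‖ι Y‖ ≤ ‖Y‖) (H : 𝒳 →L[ℂ] 𝒴)
    (hH : ∀ X, ‖H X‖ ≤ B₀ * ‖X‖) (hq : 9 * C₂ * B₀ * (ε₄ + B₀ * b) < 1) (hRC : 3 * (ε₄ + B₀ * b) ≤ R)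
    -- weight read-outs, per-term pairs, coupling
    {𝔭 : Type*} (Pw : Finset 𝔭) (ℓw : 𝔭 → List (𝒴 →L[ℂ] Matrix n n ℂ))
    {𝔱 : Type*} (I : Finset 𝔱) {Ef : 𝔱 → 𝒴 → ℂ} {rE : ℝ} {eb : 𝔱 → ℝ} {Hbar : ℝ}
    (hEb : ∀ i ∈ I, ∀ Z ∈ ball (0 : 𝒴) rE, ‖Ef i Z‖ ≤ eb i) (hsum : ∑ i ∈ I, 2 * eb i ≤ Hbar)
    (hcoupE : (ε₄ + B₀ * b) + B₀ * (4 * C₂ * (ε₄ + B₀ * b) ^ 2) ≤ rE)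
    -- the real structure generated by `L ∋` the weight read-outs, its images, preservation
    (L : Set (𝒴 →L[ℂ] Matrix n n ℂ)) (hL : ∀ p ∈ Pw, ∀ ℓ ∈ ℓw p, ℓ ∈ L)
    (𝓡𝒵 : AddSubgroup 𝒵) (𝓡𝒴' : AddSubgroup 𝒴') (𝓡𝒳 : AddSubgroup 𝒳) (h𝓡𝒳 : IsClosed (𝓡𝒳 : Set 𝒳))
    (𝓡ℬ : AddSubgroup ℬ)
    (h𝒢r : ∀ f ∈ 𝓡𝒵, 𝒢 f ∈ readOutReal L) (hWr : ∀ Y ∈ readOutReal L, W𝒱 Y ∈ 𝓡𝒵)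
    (hιr : ∀ Y ∈ readOutReal L, ι Y ∈ 𝓡𝒴') (hHr : ∀ X ∈ 𝓡𝒳, H X ∈ readOutReal L)
    (hCr : ∀ Z ∈ 𝓡𝒴', C Z ∈ 𝓡𝒳) (hH₁r : ∀ B ∈ 𝓡ℬ, H₁ B ∈ readOutReal L)
    (hΦr : ∀ y : Fin m₀ → ℝ, ‖y‖ ≤ S → Φ (cplx y) ∈ 𝓡ℬ)
    {β : ℝ} (hβ : 0 ≤ β) {y : Fin m₀ → ℝ} (hy : ‖y‖ ≤ S) :
    weight (matrixTrace (n := n)) β Pw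
        (fun p => holOf (ℓw p) (fun y => landauExp C ι H (4 * C₂ * (ε₄ + B₀ * b) ^ 2)
          (solAt 𝒢 0 W𝒱 ε₄ (0 : 𝒵) (H₁ (Φ (cplx y))) + H₁ (Φ (cplx y)))))
        (fun y => (∑ i ∈ I, Ef i (landauExp C ι H (4 * C₂ * (ε₄ + B₀ * b) ^ 2)
          (solAt 𝒢 0 W𝒱 ε₄ (0 : 𝒵) (H₁ (Φ (cplx y))) + H₁ (Φ (cplx y))))).re) y ≤
      ENNReal.ofReal (Real.exp (Hbar / 2)) := by
  -- the exponent field at the real point `y`: real, and in the terms' ball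
  set Z : 𝒴 := landauExp C ι H (4 * C₂ * (ε₄ + B₀ * b) ^ 2)
    (solAt 𝒢 0 W𝒱 ε₄ (0 : 𝒵) (H₁ (Φ (cplx y))) + H₁ (Φ (cplx y))) with hZdef
  have hZr : Z ∈ (readOutReal L : Set 𝒴) :=
    landauField_mem_real h𝒢 hW hB₀ hC₄ hε₄ hdom hself hcontr H₁ hH₁ hΦ hSr hC₂ hCq hCd ι hι H hH hq hRC
      (readOutReal L) (isClosed_readOutReal L) 𝓡𝒵 𝓡𝒴' 𝓡𝒳 h𝓡𝒳 𝓡ℬ h𝒢r hWr hιr hHr hCr hH₁r hΦr hy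
  have hZb : Z ∈ ball (0 : 𝒴) rE :=
    landauField_mem_ball hS h𝒢 hW hB₀ hC₄ hε₄ hdom hself hcontr H₁ hH₁ hΦd hΦ0 hΦ hSr hC₂ hCq hCd ι hι H hH hq
      hRC hcoupE hy
  refine weight_le_of_bounds (matrixTrace (n := n)) matrixTrace_N_pos hβ Pw ?_ ?_
  · intro p hp  -- the weight words contract
    rw [holOf_apply]
    refine norm_wordExp_le_one _ fun a ha => ?_
    obtain ⟨ℓ, hℓ, rfl⟩ := List.mem_map.1 ha
    exact (hℓr_matrix_readOutReal Pw ℓw L hL p hp ℓ hℓ Z hZr).2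
  · have h2 : ‖∑ i ∈ I, Ef i Z‖ ≤ ∑ i ∈ I, eb i :=
      (norm_sum_le _ _).trans (Finset.sum_le_sum fun i hi => hEb i hi Z hZb)
    have h3 : ∑ i ∈ I, eb i ≤ Hbar / 2 := by rw [← Finset.mul_sum] at hsum; linarith
    have h1 : |(∑ i ∈ I, Ef i Z).re| ≤ ‖∑ i ∈ I, Ef i Z‖ := Complex.abs_re_le_norm _
    show -(Hbar / 2) ≤ (∑ i ∈ I, Ef i Z).re
    linarith [(abs_le.1 h1).1]

end Landau

/-! ## §4 The S22 END read in print -/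

section EndPrint

open scoped Matrix.Norms.L2Operator

variable {P : Params} {j : ℕ} [DecidableEq (PBond P j)]
variable {n : Type*} [Fintype n] [DecidableEq n] [Nonempty n]
variable {𝒴 𝒴' 𝒳 𝒵 ℬ : Type*} [NormedAddCommGroup 𝒴] [NormedSpace ℂ 𝒴] [CompleteSpace 𝒴]
  [NormedAddCommGroup 𝒴'] [NormedSpace ℂ 𝒴'] [NormedAddCommGroup 𝒳] [NormedSpace ℂ 𝒳] [CompleteSpace 𝒳]
  [NormedAddCommGroup 𝒵] [NormedSpace ℂ 𝒵] [NormedAddCommGroup ℬ] [NormedSpace ℂ ℬ]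

/-- **REALIZED (M1) PER SLOT (`G = SU(2)`) ON THE S22 ROAD, READ IN PRINT** — file (F)'s
`slotAC_realized_su2_landauChart_threeSided_skew` with (i) `R`/`hR`/`hFw`/`hfin` GONE: the window is the ball SUPPORT
`hFsupp` of the `T`-gauged sections about `c V` (print's (1.27) SHAPE; S20 `window_of_ballSupport`), `hRdict` reads on
the density's own sections, the kept co-tests are `≤ 1` (`hJ1`), and `hfin` is a THEOREM (§2 + §3); (ii) the abstract
numerics `hdom`/`hself`/`hcontr`/`hq`/`hRC` GONE: Prop. 6's printed smallness `2B₀C₁B₃ε₁ ≤ ε₄`, `4ε₄ ≤ a₃`,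
`16B₀C₄ε₄ ≤ 1` with `dL ≤ B₃` (p. 295), Prop. 3's `18C₂B₀ε₃ ≤ 1` (p. 286) and the located coupling `ε₄ + 2dLB₀C₁ε₁ ≤ ε₃`,
`3ε₃ ≤ R_C` instead (LD f3 BY NAME); the coarse-field bound is print's `b = 2dLC₁ε₁` ((75)).  Every other binder VERBATIM
from (F) with `b := 2dLC₁ε₁`.  CONCLUSION: E2′'s, literally, in that currency.  A junction; CONDITIONAL on every binder;
nothing PRINTED is asserted; NOT Bałaban's minimiser or effective action; NE7c NOT PROVED. [folklore] -/
theorem slotAC_realized_su2_landauChart_print {T : Finset (PBond P j)} (hT : NoClosedLoop T)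
    (U₀ : GaugeField P j SU2) (Λ : Finset (PBond P j)) {m₀ : ℕ} (e : ↥Λ × Fin 3 ≃ Fin m₀)
    {S : ℝ} (hS : 0 < S) (hSπ : 3 * S ^ 2 < Real.pi ^ 2) (c : GaugeField P j SU2 → GaugeField P j SU2)
    {F : GaugeField P j SU2 → ℝ≥0∞} (hF : Measurable F) (hFi : GaugeInvariant F)
    -- print's (1.27) window as a SUPPORT property of the `T`-gauged sections (S20)
    (hFsupp : ∀ V y, F (fixTo T U₀ (updateFinset V Λ y)) ≠ 0 →
      ∀ b (hb : b ∈ Λ), dist1 ((c V b)⁻¹ * y ⟨b, hb⟩) ≤ 2 * Real.sin (S / 2))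
    {u : GaugeField P j SU2 → ℝ} (hu : Measurable u) (hui : GaugeInvariant u)
    -- plaquette index sets, window, co-test
    {ι κ : Type*} {Pu : Finset ι} (hPu : Pu.Nonempty) (Pw : Finset κ)
    (W : GaugeField P j SU2 → Set (Fin m₀ → ℝ)) (Jco : GaugeField P j SU2 → (Fin m₀ → ℝ) → ℝ≥0∞)
    {θ δ ρ β : ℝ}
    -- THE SCHEME OPERATORS per exterior section with V-uniform constants ((P2), (P4), (103), (75), (44), scaling, (46))
    (𝒢 : GaugeField P j SU2 → (𝒵 →L[ℂ] 𝒴)) (W𝒱 : GaugeField P j SU2 → 𝒴 → 𝒵) {B₀ C₄ a₃ ε₄ : ℝ}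
    (h𝒢 : ∀ V f, ‖𝒢 V f‖ ≤ B₀ * ‖f‖) (hW : ∀ V, Prop4Hyp (W𝒱 V) C₄ a₃) (hB₀ : 0 < B₀) (hC₄ : 0 ≤ C₄)
    (hε₄ : 0 ≤ ε₄)
    -- Prop. 6's PRINTED smallness (p. 295) with `dL ≤ B₃`; the coarse-field size `2dLC₁ε₁` of (75)
    {dL C₁ B₃ ε₁ : ℝ} (hdL : 0 ≤ dL) (hC₁ : 0 ≤ C₁) (hε₁ : 0 ≤ ε₁) (hB₃ : dL ≤ B₃)
    (h1 : 2 * B₀ * C₁ * B₃ * ε₁ ≤ ε₄) (h2 : 4 * ε₄ ≤ a₃) (h3 : 16 * B₀ * C₄ * ε₄ ≤ 1)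
    (H₁ : GaugeField P j SU2 → (ℬ →L[ℂ] 𝒴)) (hH₁ : ∀ V B, ‖H₁ V B‖ ≤ B₀ * ‖B‖)
    (Φ : GaugeField P j SU2 → (Fin m₀ → ℂ) → ℬ) {rΦ : ℝ} (hΦd : ∀ V, DifferentiableOn ℂ (Φ V) (ball 0 rΦ))
    (hΦ0 : ∀ V, Φ V 0 = 0) (hΦ : ∀ V, ∀ z ∈ ball (0 : Fin m₀ → ℂ) rΦ, ‖Φ V z‖ < 2 * dL * C₁ * ε₁) (hSr : S < rΦ)
    (Cf : GaugeField P j SU2 → 𝒴' → 𝒳) {C₂ RC : ℝ} (hC₂ : 0 ≤ C₂)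
    (hCq : ∀ V, ∀ Z : 𝒴', ‖Z‖ < RC → ‖Cf V Z‖ ≤ C₂ * ‖Z‖ ^ 2) (hCd : ∀ V, DifferentiableOn ℂ (Cf V) (ball 0 RC))
    (ιs : GaugeField P j SU2 → (𝒴 →L[ℂ] 𝒴')) (hι : ∀ V Y, ‖ιs V Y‖ ≤ ‖Y‖)
    (Hop : GaugeField P j SU2 → (𝒳 →L[ℂ] 𝒴)) (hH : ∀ V X, ‖Hop V X‖ ≤ B₀ * ‖X‖)
    -- Prop. 3's PRINTED smallness (p. 286) + the located coupling into its domain and B13's domain condition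
    {ε₃ : ℝ} (h18 : 18 * C₂ * B₀ * ε₃ ≤ 1) (hcoup : ε₄ + B₀ * (2 * dL * C₁ * ε₁) ≤ ε₃) (h3R : 3 * ε₃ ≤ RC)
    -- the classifier read-outs, the WEIGHT read-outs, the per-term functionals — values in `M_n(ℂ)`
    (ℓs : ι → List (𝒴 →L[ℂ] Matrix n n ℂ)) {κr : ℝ} (hκ : 0 ≤ κr)
    (hℓ : ∀ p ∈ Pu, ∀ ℓ ∈ ℓs p, ∀ Y, ‖ℓ Y‖ ≤ κr * ‖Y‖) {m : ℕ} (hlen : ∀ p ∈ Pu, (ℓs p).length ≤ m)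
    (ℓw : κ → List (𝒴 →L[ℂ] Matrix n n ℂ)) {κw : ℝ} (hκw : 0 ≤ κw)
    (hℓw : ∀ p ∈ Pw, ∀ ℓ ∈ ℓw p, ∀ Y, ‖ℓ Y‖ ≤ κw * ‖Y‖) {mw : ℕ} (hlenw : ∀ p ∈ Pw, (ℓw p).length ≤ mw)
    {𝔱 : Type*} (I : Finset 𝔱) (Ef : GaugeField P j SU2 → 𝔱 → 𝒴 → ℂ) {rE : ℝ} {eb : 𝔱 → ℝ} {Hbar : ℝ}
    (hEd : ∀ V, ∀ i ∈ I, DifferentiableOn ℂ (Ef V i) (ball 0 rE))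
    (hEb : ∀ V, ∀ i ∈ I, ∀ Z ∈ ball (0 : 𝒴) rE, ‖Ef V i Z‖ ≤ eb i) (hsum : ∑ i ∈ I, 2 * eb i ≤ Hbar)
    (hcoupE : (ε₄ + B₀ * (2 * dL * C₁ * ε₁)) + B₀ * (4 * C₂ * (ε₄ + B₀ * (2 * dL * C₁ * ε₁)) ^ 2) ≤ rE)
    -- THE REAL STRUCTURE GENERATED BY A READ-OUT SET `L` containing the weight read-outs; its images; preservation
    (L : Set (𝒴 →L[ℂ] Matrix n n ℂ)) (hL : ∀ p ∈ Pw, ∀ ℓ ∈ ℓw p, ℓ ∈ L)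
    (𝓡𝒵 : AddSubgroup 𝒵) (𝓡𝒴' : AddSubgroup 𝒴') (𝓡𝒳 : AddSubgroup 𝒳) (h𝓡𝒳 : IsClosed (𝓡𝒳 : Set 𝒳))
    (𝓡ℬ : AddSubgroup ℬ)
    (h𝒢r : ∀ V, ∀ f ∈ 𝓡𝒵, 𝒢 V f ∈ readOutReal L) (hWr : ∀ V, ∀ Y ∈ readOutReal L, W𝒱 V Y ∈ 𝓡𝒵)
    (hιr : ∀ V, ∀ Y ∈ readOutReal L, ιs V Y ∈ 𝓡𝒴') (hHr : ∀ V, ∀ X ∈ 𝓡𝒳, Hop V X ∈ readOutReal L)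
    (hCr : ∀ V, ∀ Z ∈ 𝓡𝒴', Cf V Z ∈ 𝓡𝒳) (hH₁r : ∀ V, ∀ B ∈ 𝓡ℬ, H₁ V B ∈ readOutReal L)
    (hΦr : ∀ V, ∀ y : Fin m₀ → ℝ, ‖y‖ ≤ S → Φ V (cplx y) ∈ 𝓡ℬ)
    -- DICTIONARY (on the chart cube only): the density's OWN sections with the DEFINED weight words and non-Wilson
    -- term; the tested variable with the DEFINED classifier holonomies — all of the SAME exponent field
    (hRdict : ∀ V, ∀ x ∈ cube m₀ S,
      F (fixTo T U₀ (updateFinset V Λ (expFibreChart Λ (c V) e x))) = Jco V x * weight (matrixTrace (n := n)) β Pw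
        (fun p => holOf (ℓw p) (fun y => landauExp (Cf V) (ιs V) (Hop V)
          (4 * C₂ * (ε₄ + B₀ * (2 * dL * C₁ * ε₁)) ^ 2)
          (solAt (𝒢 V) 0 (W𝒱 V) ε₄ (0 : 𝒵) (H₁ V (Φ V (cplx y))) + H₁ V (Φ V (cplx y)))))
        (fun y => (∑ i ∈ I, Ef V i (landauExp (Cf V) (ιs V) (Hop V)
          (4 * C₂ * (ε₄ + B₀ * (2 * dL * C₁ * ε₁)) ^ 2)
          (solAt (𝒢 V) 0 (W𝒱 V) ε₄ (0 : 𝒵) (H₁ V (Φ V (cplx y))) + H₁ V (Φ V (cplx y))))).re) x)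
    (hudict : ∀ V, ∀ x ∈ cube m₀ S,
      u (fixTo T U₀ (updateFinset V Λ (expFibreChart Λ (c V) e x))) =
        classifier hPu (fun p => holOf (ℓs p) (fun y => landauExp (Cf V) (ιs V) (Hop V)
          (4 * C₂ * (ε₄ + B₀ * (2 * dL * C₁ * ε₁)) ^ 2)
          (solAt (𝒢 V) 0 (W𝒱 V) ε₄ (0 : 𝒵) (H₁ V (Φ V (cplx y))) + H₁ V (Φ V (cplx y))))) x)
    -- co-tests: supported in the window, centre-monotone, AT MOST ONE; the window inside the chart ball
    (hJW : ∀ V x, Jco V x ≠ 0 → x ∈ W V)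
    (hJ : ∀ V x, ∀ a : ℝ, 0 ≤ a → Jco V x ≤ Jco V (Real.exp (-a) • x))
    (hJ1 : ∀ V x, Jco V x ≤ 1)
    (hWS : ∀ V, W V ⊆ closedBall (0 : Fin m₀ → ℝ) S)
    -- numbers + the weight-side smallness + SM-L2 (SM) in the currency `Rad = r_Φ / S`
    (hθ : 0 < θ) (hδ0 : 0 ≤ δ) (hδ1 : δ < 1) (hρ0 : 0 ≤ ρ) (hρ : ρ ≤ (1 - δ) / 2) (hβ : 0 ≤ β)
    (hsw1 : mw * (κw * ((ε₄ + B₀ * (2 * dL * C₁ * ε₁)) +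
      B₀ * (4 * C₂ * (ε₄ + B₀ * (2 * dL * C₁ * ε₁)) ^ 2))) ≤ 1)
    (hSM : 36 * (Real.exp (m * (κr * ((ε₄ + B₀ * (2 * dL * C₁ * ε₁)) +
      B₀ * (4 * C₂ * (ε₄ + B₀ * (2 * dL * C₁ * ε₁)) ^ 2)))) - 1) * 1 ^ 2 / (rΦ / S - 1) ^ 2 ≤ δ * θ) :
    SlotAntiConcentration ((fieldMeasure P j SU2).withDensity F) u θ ρ
      (2 * ((m₀ : ℝ) + (β * ∑ _p ∈ Pw,
        (mw * (3 * (κw * ((ε₄ + B₀ * (2 * dL * C₁ * ε₁)) +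
          B₀ * (4 * C₂ * (ε₄ + B₀ * (2 * dL * C₁ * ε₁)) ^ 2))) / (rΦ / S - 1))) *
          (0 + 4 * (mw * (κw * ((ε₄ + B₀ * (2 * dL * C₁ * ε₁)) +
            B₀ * (4 * C₂ * (ε₄ + B₀ * (2 * dL * C₁ * ε₁)) ^ 2))))) +
        3 * Hbar / (rΦ / S - 1))) / (1 - δ)) := by
  -- the printed smallness gives the scheme numerics ((118)/(121) at the ray; (54) at `ε₄ + 2dLB₀C₁ε₁`)
  obtain ⟨hdom, hself, hcontr, -⟩ := scheme_numbers_of_printed hdL hB₀.le hC₁ hC₄ hε₁ hε₄ hB₃ h1 h2 h3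
  have hself' : B₀ * C₄ * (ε₄ + B₀ * (2 * dL * C₁ * ε₁)) ^ 2 ≤ ε₄ := by simpa using hself
  have hcontr' : 4 * B₀ * C₄ * (ε₄ + B₀ * (2 * dL * C₁ * ε₁)) < 1 := by simpa using hcontr
  obtain ⟨hq, hRC⟩ := sectC_numbers_of_printed hC₂ hB₀.le h18 hcoup h3R
  -- (LR)_j from the ball support (S20); the block weight is the density's own section
  have hR : ∀ V, Measurable fun y : ↥Λ → SU2 => F (fixTo T U₀ (updateFinset V Λ y)) :=
    fun _ => hF.comp ((measurable_fixTo T U₀).comp measurable_updateFinset)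
  have hFw := window_of_ballSupport T U₀ Λ c hS.le hFsupp
  -- the finiteness proviso: the density on the cube is co-test × a weight bounded by `e^{H̄/2}`
  have hfin : ∀ V, ((blockLaw Λ).withDensity fun y => F (fixTo T U₀ (updateFinset V Λ y))) univ ≠ ∞ := by
    refine hfin_of_cubeBound T U₀ Λ e hS hSπ c hR hFw (K := 1 * ENNReal.ofReal (Real.exp (Hbar / 2)))
      (ENNReal.mul_ne_top ENNReal.one_ne_top ENNReal.ofReal_ne_top) fun V x hx => ?_
    show F (fixTo T U₀ (updateFinset V Λ (expFibreChart Λ (c V) e x))) ≤ _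
    rw [hRdict V x hx]
    exact mul_le_mul' (hJ1 V x)
      (landauWeight_le hS (h𝒢 V) (hW V) hB₀ hC₄ hε₄ hdom hself' hcontr' (H₁ V) (hH₁ V) (hΦd V) (hΦ0 V) (hΦ V)
        hSr hC₂ (hCq V) (hCd V) (ιs V) (hι V) (Hop V) (hH V) hq hRC Pw ℓw I (hEb V) hsum hcoupE L hL 𝓡𝒵 𝓡𝒴' 𝓡𝒳
        h𝓡𝒳 𝓡ℬ (h𝒢r V) (hWr V) (hιr V) (hHr V) (hCr V) (hH₁r V) (hΦr V) hβ
        (mem_closedBall_zero_iff.1 (chartCube_subset_closedBall hS.le hx)))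
  exact slotAC_realized_su2_landauChart_threeSided_skew hT U₀ Λ e hS hSπ c hR hF hFi hFw hfin hu hui hPu Pw W Jco
    𝒢 W𝒱 h𝒢 hW hB₀ hC₄ hε₄ hdom hself' hcontr' H₁ hH₁ Φ hΦd hΦ0 hΦ hSr Cf hC₂ hCq hCd ιs hι Hop hH hq hRC ℓs hκ hℓ
    hlen ℓw hκw hℓw hlenw I Ef hEd hEb hsum hcoupE L hL 𝓡𝒵 𝓡𝒴' 𝓡𝒳 h𝓡𝒳 𝓡ℬ h𝒢r hWr hιr hHr hCr hH₁r hΦr hRdict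
    hudict hJW hJ hWS hθ hδ0 hδ1 hρ0 hρ hβ hsw1 hSM

end EndPrint

end Summit.QuantumFields.BalabanUV.T4Continuum.ShellMeasureLandauHolonomyPrint

end
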